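import Summits.QuantumFields.YangMills.Theorems.FluctuationComparisonRegPrIntLGapFlatOfOrbBarMorseBott
import Summits.QuantumFields.YangMills.Theorems.FluctuationComparisonRegPrIntLS2BetaInterBlock
import HarnessLib

/-!
# TUBE♭ ⟸ {POS∘, ISOL∘(δ)} — QUADRATIC GROWTH ALONG ONE RESIDUAL ORBIT INSIDE A SUP-TUBE, BY COMPACTNESS; AND, WITH CLOSE-PAIR∘ (✓p791830), GAP♭ FROM THE TUBE LETTERS
# (crux `FluctuationComparisonRegPrIntL`, stmt-QuantumFields-20520; registry v11.4 `Cruxes/FluctuationComparisonRegPrIntL/Lines/semiclassical_s2beta.lean` 3732b7df FROZEN, untouched)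

Cell `ym3-torus` (YM ladder rung R3 = continuum `SU(2)` Yang–Mills on the three-torus — a RUNG: NOT d = 4, NOT infinite volume, NOT a mass gap, NOT Clay).
Seat `ym3-torus-px8` (gen 18); pen named by LEAD w3 g23 WORD №17 (i) after ★★OWNER g40 №213 (B) and px17 g14's pointer; `--kind proof --supports stmt-QuantumFields-20520
--as helper`, count-neutral, DEFINITION-FREE (0 `def`, 0 `instance`, 0 `notation`, 0 `sorry`, default heartbeats).  Plan: HOME `ym3-torus-px8/g18/locate/LOCATE-TUBE-REG-px8g18.md` §3b–§3c.

WHY.  In the landed TUBE-REG∘ text (the `hT1` binder of ✓`…S2BetaInterBlock.uniformFibreGapOrbit_of_tubeReg_of_thm1`) the tube radius `δ` is fixed BEFORE the datum, so the per-datum,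
per-base-point growth TUBE♭(V, U₀) («`μ·L^{−2(K−J)}·⨅_w Σ dist1² ≤ A − min` for every good history of the fibre within the UNIVERSAL `δ` of the residual orbit of `U₀`») needs TWO
inputs: POS∘(U₀) — quadratic growth on SOME collar of the orbit (the per-datum shadow of [Balaban1985Variational] (142) «the second order differential … is positive definite») — and
ISOL∘(δ) — inside the closed `δ`-tube the action reaches the (6)-minimum only on the orbit.  Their glue is finite-dimensional compactness (`SU(2)^{bonds}` compact; the residual set
compact, ✓`isCompact_residualGauge`; the orbit functional continuous, ✓`continuous_iInf_orbitDistSq`), the TUBE-LOCAL twin of px17 g14's ✓`gapFlatAt_of_orbBar_of_morseBott` (ORB̄ ∧ MB ⇒ GAP♭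
on the whole closed good fibre).  With CLOSE-PAIR∘ — a tree theorem since ✓p791830 `closePair_holds` — every good history of the fibre IS within `δ` of the orbit once `γ ≤ γ₁(L, b₀, p₀, δ)`,
so the tube letters give GAP♭ itself: isolation and growth need only be checked inside an arbitrarily thin sup-tube, which is print's mechanism ([Balaban1985UV3] p.259 after (12):
Lemma 1 [6] first, then the expansion (18)–(22) inside the tube) made formal per datum.

WHAT.
* §1 ★ `exists_growth_of_collar_of_isolated` — THE ABSTRACT GLUE (any topological space): `S` compact, `f, D` continuous, `D ≥ 0` on `S`, collar growth `D ≤ r ⇒ c·D ≤ f − m` and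
  isolation `f ≤ m ⇒ D = 0` on `S` ⟹ `∃ μ > 0, μ·D ≤ f − m` on `S` (`μ = min c (ε∕M)`, `ε` = the minimum of `f − m` on `S ∩ {r ≤ D}`, `M` = the maximum of `D` on `S`).
* §2 ★ `isClosed_tube` — the sup-tube `{U | ∃ w residual, ∀ ℓ, dist1 (U ℓ·((w•U₀) ℓ)⁻¹) ≤ δ}` is closed (image of a compact set under the second projection).
* §3 ★★ `tubeGrowth_of_pos_of_isolated` — TUBE♭(V,U₀) ⟸ POS∘ ∧ ISOL∘(δ), both letters read on `closure (fibre ∩ histGood) ∩ tube`.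
* §4 ★★★ `gapFlatAt_of_pos_of_isolated_of_closePair` — for `γ ≤ γ₁(L, b₀, p₀, δ)` of ✓`closePair_holds`: POS∘ ∧ ISOL∘(δ) at a datum whose base point `U₀` is a good history of the fibre
  ⟹ GAP♭(V,U₀) (px17's conclusion text of ✓`gapFlatAt_of_orbBar_of_morseBott`, token for token).

HONEST: compactness bookkeeping; POS∘ and ISOL∘(δ) are DISPLAYED HYPOTHESES (print's (142) and its tube-wide consequence — analytic, NOT proved here); TUBE-REG∘, GAP♯∘, GAP♭, EXW∘, S2β,
crux 20520 NOT proved; the `K`-uniform modulus is not addressed (px17's CERTs 8e6b4fe2 ∕ 603780ac: unconsumed); no summit statement is proved by a helper; finite-volume ∕ conditional;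
rung R3 = SU(2) YM₃ on T³ — NOT d = 4, NOT infinite volume, NOT a mass gap, NOT Clay; the Yang–Mills mass gap is NOT proved.  Sorry-free, axioms standard.

References: T. Bałaban, CMP **102** (1985) 277–309 [Balaban1985Variational] (Thm 1 (8)–(10) p.279, (142) p.299); CMP **102** (1985) 255–275 [Balaban1985UV3] ((12)–(13) p.259,
(18)–(22) p.260); CMP **99** (1985) 75–102 [Balaban1985RegularSpaces] (Lemma 1 (1.24)–(1.26) pp.79–80).
-/

set_option autoImplicit false

noncomputable section

namespace Summit.QuantumFields.YangMills.Theorems.FluctuationComparisonRegPrIntLS2BetaTubeGrowthOfIsolated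

open Set Filter Topology
open Literature.MathematicalPhysics.QuantumFieldTheory.Balaban1983to89
open Literature.MathematicalPhysics.QuantumFieldTheory.Balaban1983to89.T3ContinuumYM3Torus
open Literature.MathematicalPhysics.QuantumFieldTheory.Balaban1983to89.T3UnitLawDensityEML (ℰp)
open Literature.MathematicalPhysics.QuantumFieldTheory.Balaban1983to89.T3UnitScaleTilt
open Literature.MathematicalPhysics.QuantumFieldTheory.Balaban1983to89.T3TiltDescent
open Literature.MathematicalPhysics.QuantumFieldTheory.Balaban1983to89.T3ConstrainedMinimiser (fibre)
open Literature.MathematicalPhysics.QuantumFieldTheory.Balaban1983to89.T3PrintedRegularMinimiser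
open Literature.MathematicalPhysics.QuantumFieldTheory.Balaban1983to89.T4Continuum
open scoped Literature.MathematicalPhysics.QuantumFieldTheory.Balaban1983to89.T3OrbitAverage
open Summit.QuantumFields.YangMills.Theorems.FluctuationComparisonRegPrIntLS2BetaResidualGauge
open Summit.QuantumFields.YangMills.Theorems.FluctuationComparisonRegPrIntLS2BetaResidualGaugeOrbit
open Summit.QuantumFields.YangMills.Theorems.FluctuationComparisonRegPrIntLS2BetaFibreTransport
open Summit.QuantumFields.YangMills.Theorems.FluctuationComparisonRegPrIntLS2BetaInterBlock (closePair_holds)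

/-! ## §1 The abstract glue -/

section Glue

variable {X : Type*} [TopologicalSpace X]

/-- ★ **COLLAR GROWTH + ISOLATION ⟹ GROWTH, ON A COMPACT SET.**  `S` compact; `f`, `D` continuous, `D ≥ 0` on `S`; growth `c·D x ≤ f x − m` on the collar `{D ≤ r}` (`r, c > 0`) and
isolation «`f x ≤ m ⇒ D x = 0`» on `S` ⟹ `∃ μ > 0, ∀ x ∈ S, μ·D x ≤ f x − m`.  Proof: on the compact far part `S ∩ {r ≤ D}` the excess `f − m` is positive (isolation) hence `≥ ε > 0`
(minimum attained), and `D ≤ M` on `S` (maximum attained); `μ := min c (ε∕M)`. [cite: Balaban1985Variational, (142) p.299] -/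
theorem exists_growth_of_collar_of_isolated {S : Set X} (hS : IsCompact S) {f D : X → ℝ} (hf : Continuous f) (hD : Continuous D)
    (hD0 : ∀ x ∈ S, 0 ≤ D x) {m r c : ℝ} (hr : 0 < r) (hc : 0 < c)
    (hpos : ∀ x ∈ S, D x ≤ r → c * D x ≤ f x - m) (hisol : ∀ x ∈ S, f x ≤ m → D x = 0) :
    ∃ μ : ℝ, 0 < μ ∧ ∀ x ∈ S, μ * D x ≤ f x - m := by
  set Sr : Set X := S ∩ D ⁻¹' Ici r with hSr
  have hSrc : IsCompact Sr := hS.inter_right (isClosed_Ici.preimage hD)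
  rcases Sr.eq_empty_or_nonempty with hemp | hne
  · refine ⟨c, hc, fun x hx => hpos x hx ?_⟩
    by_contra h
    have hxSr : x ∈ Sr := ⟨hx, (lt_of_not_ge h).le⟩
    rw [hemp] at hxSr
    exact hxSr
  · obtain ⟨xM, -, hmax⟩ := hS.exists_isMaxOn (hne.mono inter_subset_left) hD.continuousOn
    obtain ⟨x₀, hx₀, hmin⟩ := hSrc.exists_isMinOn hne hf.continuousOn
    obtain ⟨xr, hxr⟩ := hne
    have hMr : r ≤ D xM := le_trans (mem_Ici.mp hxr.2) (hmax hxr.1)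
    have hM0 : 0 < D xM := hr.trans_le hMr
    have hε : 0 < f x₀ - m := by
      have hDx₀ : r ≤ D x₀ := mem_Ici.mp hx₀.2
      by_contra hle
      have h0 : D x₀ = 0 := hisol x₀ hx₀.1 (by linarith)
      linarith
    refine ⟨min c ((f x₀ - m) / D xM), lt_min hc (div_pos hε hM0), fun x hx => ?_⟩
    by_cases hxr' : D x ≤ r
    · calc min c ((f x₀ - m) / D xM) * D x ≤ c * D x := mul_le_mul_of_nonneg_right (min_le_left _ _) (hD0 x hx)
        _ ≤ f x - m := hpos x hx hxr'
    · have hxSr : x ∈ Sr := ⟨hx, (lt_of_not_ge hxr').le⟩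
      have h1 : f x₀ ≤ f x := hmin hxSr
      have h2 : D x ≤ D xM := hmax hx
      calc min c ((f x₀ - m) / D xM) * D x ≤ (f x₀ - m) / D xM * D x := mul_le_mul_of_nonneg_right (min_le_right _ _) (hD0 x hx)
        _ ≤ (f x₀ - m) / D xM * D xM := mul_le_mul_of_nonneg_left h2 (div_pos hε hM0).le
        _ = f x₀ - m := div_mul_cancel₀ _ hM0.ne'
        _ ≤ f x - m := by linarith

end Glue

/-! ## §2 The sup-tube about a residual orbit is closed -/

section Tube

variable (F : T3Family) {J K : ℕ} (hJK : J ≤ K)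

/-- ★ **THE SUP-TUBE IS CLOSED**: `{U | ∃ w residual, ∀ ℓ, dist1 (U ℓ·((w•U₀) ℓ)⁻¹) ≤ δ}` is the second projection of a closed, hence compact, subset of (residual set) × `SU(2)^{bonds}`.
[cite: Balaban1985UV3, (12)-(13) p.259] -/
theorem isClosed_tube (U₀ : GaugeField (F.P K) 0 (Matrix.specialUnitaryGroup (Fin 2) ℂ)) (δ : ℝ) :
    IsClosed {U : GaugeField (F.P K) 0 (Matrix.specialUnitaryGroup (Fin 2) ℂ) |
      ∃ w : Site (F.P K) 0 → Matrix.specialUnitaryGroup (Fin 2) ℂ,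
        (∀ U'' : GaugeField (F.P K) 0 (Matrix.specialUnitaryGroup (Fin 2) ℂ),
            descendTo F ℰp J K hJK (GaugeField.gaugeAct w U'') = descendTo F ℰp J K hJK U'') ∧
          ∀ ℓ : PBond (F.P K) 0, dist1 (U ℓ * ((GaugeField.gaugeAct w U₀) ℓ)⁻¹) ≤ δ} := by
  haveI := compactSpace_residualGauge F hJK
  -- the closed graph-like set `C ⊆ Res × Fields` and its second projection
  set C : Set ({w : Site (F.P K) 0 → Matrix.specialUnitaryGroup (Fin 2) ℂ |
        ∀ U : GaugeField (F.P K) 0 (Matrix.specialUnitaryGroup (Fin 2) ℂ),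
          descendTo F ℰp J K hJK (GaugeField.gaugeAct w U) = descendTo F ℰp J K hJK U} ×
      GaugeField (F.P K) 0 (Matrix.specialUnitaryGroup (Fin 2) ℂ)) :=
    {p | ∀ ℓ : PBond (F.P K) 0,
      dist1 (p.2 ℓ * ((GaugeField.gaugeAct (p.1 : Site (F.P K) 0 → Matrix.specialUnitaryGroup (Fin 2) ℂ) U₀) ℓ)⁻¹) ≤ δ} with hC
  have hdist : Continuous (dist1 : Matrix.specialUnitaryGroup (Fin 2) ℂ → ℝ) :=
    UnitaryModel.continuous_opDist1.comp (Literature.MathematicalPhysics.QuantumLattice.continuous_fundamentalRep (Fin 2))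
  have hval : Continuous fun p : ({w : Site (F.P K) 0 → Matrix.specialUnitaryGroup (Fin 2) ℂ |
        ∀ U : GaugeField (F.P K) 0 (Matrix.specialUnitaryGroup (Fin 2) ℂ),
          descendTo F ℰp J K hJK (GaugeField.gaugeAct w U) = descendTo F ℰp J K hJK U} ×
      GaugeField (F.P K) 0 (Matrix.specialUnitaryGroup (Fin 2) ℂ)) =>
      (p.1 : Site (F.P K) 0 → Matrix.specialUnitaryGroup (Fin 2) ℂ) := continuous_subtype_val.comp continuous_fst
  have hcont : ∀ ℓ : PBond (F.P K) 0, Continuous fun p : ({w : Site (F.P K) 0 → Matrix.specialUnitaryGroup (Fin 2) ℂ |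
        ∀ U : GaugeField (F.P K) 0 (Matrix.specialUnitaryGroup (Fin 2) ℂ),
          descendTo F ℰp J K hJK (GaugeField.gaugeAct w U) = descendTo F ℰp J K hJK U} ×
      GaugeField (F.P K) 0 (Matrix.specialUnitaryGroup (Fin 2) ℂ)) =>
      dist1 (p.2 ℓ * ((GaugeField.gaugeAct (p.1 : Site (F.P K) 0 → Matrix.specialUnitaryGroup (Fin 2) ℂ) U₀) ℓ)⁻¹) := by
    intro ℓ
    have hsnd : Continuous fun p : ({w : Site (F.P K) 0 → Matrix.specialUnitaryGroup (Fin 2) ℂ |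
          ∀ U : GaugeField (F.P K) 0 (Matrix.specialUnitaryGroup (Fin 2) ℂ),
            descendTo F ℰp J K hJK (GaugeField.gaugeAct w U) = descendTo F ℰp J K hJK U} ×
        GaugeField (F.P K) 0 (Matrix.specialUnitaryGroup (Fin 2) ℂ)) =>
        (p.2 : PBond (F.P K) 0 → Matrix.specialUnitaryGroup (Fin 2) ℂ) ℓ :=
      (continuous_apply ℓ).comp continuous_snd
    exact hdist.comp
      (hsnd.mul ((((continuous_apply ℓ.src).comp hval).mul continuous_const).mul ((continuous_apply ℓ.tgt).comp hval).inv).inv)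
  have hCcl : IsClosed C := by
    have hCeq : C = ⋂ ℓ : PBond (F.P K) 0, {p | dist1 (p.2 ℓ *
        ((GaugeField.gaugeAct (p.1 : Site (F.P K) 0 → Matrix.specialUnitaryGroup (Fin 2) ℂ) U₀) ℓ)⁻¹) ≤ δ} := by
      ext p; simp only [hC, mem_setOf_eq, mem_iInter]
    rw [hCeq]
    exact isClosed_iInter fun ℓ => isClosed_le (hcont ℓ) continuous_const
  have hCc : IsCompact C := hCcl.isCompact
  have himg := (hCc.image continuous_snd).isClosed
  convert himg using 1
  ext U
  simp only [mem_setOf_eq, mem_image, Prod.exists, hC]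
  constructor
  · rintro ⟨w, hw, hU⟩
    exact ⟨⟨w, hw⟩, U, hU, rfl⟩
  · rintro ⟨w, U', hU', rfl⟩
    exact ⟨w, w.2, hU'⟩

end Tube

/-! ## §3 TUBE♭ from the two tube letters -/

section TubeFlat

variable (F : T3Family) {J K : ℕ} (hJK : J ≤ K) {γ b₀ p₀ ε₀ : ℝ}

/-- ★★ **TUBE♭(V,U₀) ⟸ POS∘(U₀) ∧ ISOL∘(δ).**  At one datum `V` and one base point `U₀`, with the orbit functional `D U := ⨅_{w residual} Σ_ℓ dist1 (U ℓ·((w•U₀) ℓ)⁻¹)²`, the excess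
`A U − min`, and `S̄ := closure (fibre ∩ histGood) ∩ {δ-tube}`: if `c·D ≤ A − min` on the collar `S̄ ∩ {D ≤ r}` (`hpos`, POS∘) and `A ≤ min ⇒ D = 0` on `S̄` (`hisol`, ISOL∘(δ)), then
`∃ μ > 0` with `μ·L^{−2(K−J)}·D U ≤ A U − min` for every good history `U` of the fibre in the `δ`-tube — the body of TUBE-REG∘ at the datum with `∃ μ` after `U₀`.
[cite: Balaban1985Variational, (142) p.299; Balaban1985UV3, (18)-(22) p.260] -/
theorem tubeGrowth_of_pos_of_isolated
    (V : GaugeField (F.P J) 0 (Matrix.specialUnitaryGroup (Fin 2) ℂ)) (U₀ : GaugeField (F.P K) 0 (Matrix.specialUnitaryGroup (Fin 2) ℂ)) (δ : ℝ)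
    (hpos : ∃ r c : ℝ, 0 < r ∧ 0 < c ∧
      ∀ U ∈ closure (fibre F ℰp J K hJK V ∩ histGood F ℰp (θBal F.L γ b₀ p₀) K J),
        (∃ w : Site (F.P K) 0 → Matrix.specialUnitaryGroup (Fin 2) ℂ,
          (∀ U'' : GaugeField (F.P K) 0 (Matrix.specialUnitaryGroup (Fin 2) ℂ),
              descendTo F ℰp J K hJK (GaugeField.gaugeAct w U'') = descendTo F ℰp J K hJK U'') ∧
            ∀ ℓ : PBond (F.P K) 0, dist1 (U ℓ * ((GaugeField.gaugeAct w U₀) ℓ)⁻¹) ≤ δ) →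
        (⨅ w : {w : Site (F.P K) 0 → Matrix.specialUnitaryGroup (Fin 2) ℂ |
            ∀ U : GaugeField (F.P K) 0 (Matrix.specialUnitaryGroup (Fin 2) ℂ),
              descendTo F ℰp J K hJK (GaugeField.gaugeAct w U) = descendTo F ℰp J K hJK U},
          ∑ ℓ : PBond (F.P K) 0,
            dist1 (U ℓ * ((GaugeField.gaugeAct (w : Site (F.P K) 0 → Matrix.specialUnitaryGroup (Fin 2) ℂ) U₀) ℓ)⁻¹) ^ 2) ≤ r →
        c * (⨅ w : {w : Site (F.P K) 0 → Matrix.specialUnitaryGroup (Fin 2) ℂ |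
            ∀ U : GaugeField (F.P K) 0 (Matrix.specialUnitaryGroup (Fin 2) ℂ),
              descendTo F ℰp J K hJK (GaugeField.gaugeAct w U) = descendTo F ℰp J K hJK U},
          ∑ ℓ : PBond (F.P K) 0,
            dist1 (U ℓ * ((GaugeField.gaugeAct (w : Site (F.P K) 0 → Matrix.specialUnitaryGroup (Fin 2) ℂ) U₀) ℓ)⁻¹) ^ 2)
          ≤ wilsonAction4 U - minActionRegPr F J K hJK ε₀ V)
    (hisol : ∀ U ∈ closure (fibre F ℰp J K hJK V ∩ histGood F ℰp (θBal F.L γ b₀ p₀) K J),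
        (∃ w : Site (F.P K) 0 → Matrix.specialUnitaryGroup (Fin 2) ℂ,
          (∀ U'' : GaugeField (F.P K) 0 (Matrix.specialUnitaryGroup (Fin 2) ℂ),
              descendTo F ℰp J K hJK (GaugeField.gaugeAct w U'') = descendTo F ℰp J K hJK U'') ∧
            ∀ ℓ : PBond (F.P K) 0, dist1 (U ℓ * ((GaugeField.gaugeAct w U₀) ℓ)⁻¹) ≤ δ) →
        wilsonAction4 U ≤ minActionRegPr F J K hJK ε₀ V →
        (⨅ w : {w : Site (F.P K) 0 → Matrix.specialUnitaryGroup (Fin 2) ℂ |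
            ∀ U : GaugeField (F.P K) 0 (Matrix.specialUnitaryGroup (Fin 2) ℂ),
              descendTo F ℰp J K hJK (GaugeField.gaugeAct w U) = descendTo F ℰp J K hJK U},
          ∑ ℓ : PBond (F.P K) 0,
            dist1 (U ℓ * ((GaugeField.gaugeAct (w : Site (F.P K) 0 → Matrix.specialUnitaryGroup (Fin 2) ℂ) U₀) ℓ)⁻¹) ^ 2) = 0) :
    ∃ μ : ℝ, 0 < μ ∧ ∀ U ∈ fibre F ℰp J K hJK V, U ∈ histGood F ℰp (θBal F.L γ b₀ p₀) K J →
      (∃ w : Site (F.P K) 0 → Matrix.specialUnitaryGroup (Fin 2) ℂ,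
        (∀ U'' : GaugeField (F.P K) 0 (Matrix.specialUnitaryGroup (Fin 2) ℂ),
            descendTo F ℰp J K hJK (GaugeField.gaugeAct w U'') = descendTo F ℰp J K hJK U'') ∧
          ∀ ℓ : PBond (F.P K) 0, dist1 (U ℓ * ((GaugeField.gaugeAct w U₀) ℓ)⁻¹) ≤ δ) →
      μ * ((F.L : ℝ)⁻¹) ^ (2 * (K - J)) *
          (⨅ w : {w : Site (F.P K) 0 → Matrix.specialUnitaryGroup (Fin 2) ℂ |
              ∀ U : GaugeField (F.P K) 0 (Matrix.specialUnitaryGroup (Fin 2) ℂ),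
                descendTo F ℰp J K hJK (GaugeField.gaugeAct w U) = descendTo F ℰp J K hJK U},
            ∑ ℓ : PBond (F.P K) 0,
              dist1 (U ℓ * ((GaugeField.gaugeAct (w : Site (F.P K) 0 → Matrix.specialUnitaryGroup (Fin 2) ℂ) U₀) ℓ)⁻¹) ^ 2)
        ≤ wilsonAction4 U - minActionRegPr F J K hJK ε₀ V := by
  classical
  set g : GaugeField (F.P K) 0 (Matrix.specialUnitaryGroup (Fin 2) ℂ) → ℝ := fun U =>
    ⨅ w : {w : Site (F.P K) 0 → Matrix.specialUnitaryGroup (Fin 2) ℂ |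
        ∀ U : GaugeField (F.P K) 0 (Matrix.specialUnitaryGroup (Fin 2) ℂ),
          descendTo F ℰp J K hJK (GaugeField.gaugeAct w U) = descendTo F ℰp J K hJK U},
      ∑ ℓ : PBond (F.P K) 0,
        dist1 (U ℓ * ((GaugeField.gaugeAct (w : Site (F.P K) 0 → Matrix.specialUnitaryGroup (Fin 2) ℂ) U₀) ℓ)⁻¹) ^ 2 with hg_def
  set f : GaugeField (F.P K) 0 (Matrix.specialUnitaryGroup (Fin 2) ℂ) → ℝ := fun U => wilsonAction4 U with hf_def
  set T : Set (GaugeField (F.P K) 0 (Matrix.specialUnitaryGroup (Fin 2) ℂ)) :=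
    {U | ∃ w : Site (F.P K) 0 → Matrix.specialUnitaryGroup (Fin 2) ℂ,
      (∀ U'' : GaugeField (F.P K) 0 (Matrix.specialUnitaryGroup (Fin 2) ℂ),
          descendTo F ℰp J K hJK (GaugeField.gaugeAct w U'') = descendTo F ℰp J K hJK U'') ∧
        ∀ ℓ : PBond (F.P K) 0, dist1 (U ℓ * ((GaugeField.gaugeAct w U₀) ℓ)⁻¹) ≤ δ} with hT_def
  set S : Set (GaugeField (F.P K) 0 (Matrix.specialUnitaryGroup (Fin 2) ℂ)) :=
    closure (fibre F ℰp J K hJK V ∩ histGood F ℰp (θBal F.L γ b₀ p₀) K J) ∩ T with hS_def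
  have hgc : Continuous g := continuous_iInf_orbitDistSq F hJK U₀
  have hfc : Continuous f := B16Thm1BaseAtRecord11.continuous_wilsonAction4_SU (N := 2) (F.P K) 0
  have hg0 : ∀ U, 0 ≤ g U := fun U => Real.iInf_nonneg fun w => Finset.sum_nonneg fun ℓ _ => sq_nonneg _
  have hTcl : IsClosed T := isClosed_tube F hJK U₀ δ
  have hScpt : IsCompact S := (isClosed_closure.inter hTcl).isCompact
  obtain ⟨r, c, hr, hc, hpos⟩ := hpos
  obtain ⟨μ, hμ, hgrow⟩ := exists_growth_of_collar_of_isolated (m := minActionRegPr F J K hJK ε₀ V) hScpt hfc hgc (fun U _ => hg0 U) hr hc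
    (fun U hU hUr => hpos U hU.1 hU.2 hUr) (fun U hU hle => hisol U hU.1 hU.2 hle)
  have hLpos : (0 : ℝ) < (F.L : ℝ) := Nat.cast_pos.mpr (lt_trans zero_lt_one F.hL.2)
  have hη : 0 < ((F.L : ℝ)⁻¹) ^ (2 * (K - J)) := pow_pos (inv_pos.mpr hLpos) _
  refine ⟨μ / ((F.L : ℝ)⁻¹) ^ (2 * (K - J)), div_pos hμ hη, fun U hUf hUg hUt => ?_⟩
  rw [div_mul_cancel₀ _ hη.ne']
  exact hgrow U ⟨subset_closure ⟨hUf, hUg⟩, hUt⟩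

end TubeFlat

/-! ## §4 With CLOSE-PAIR∘: GAP♭ from the tube letters -/

section GapFlat

/-- ★★★ **GAP♭(V,U₀) ⟸ POS∘(U₀) ∧ ISOL∘(δ), FOR `γ ≤ γ₁(L, b₀, p₀, δ)` OF CLOSE-PAIR∘.**  For every `L`, `b₀, p₀ > 0` and every tube radius `δ > 0` there is `γ₁ > 0` (that of
✓`closePair_holds`) such that at every datum `V` of every run with `γ ≤ γ₁`, and every base point `U₀` which is itself a good history of the fibre, the two tube letters give the
per-datum gap: `∃ μ > 0, μ·L^{−2(K−J)}·⨅_w Σ dist1² ≤ A U − min` for EVERY good history `U` of the fibre (px17 g14's GAP♭ text) — because CLOSE-PAIR∘ puts every such `U` inside the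
`δ`-tube about the orbit of `U₀`.  [cite: Balaban1985UV3, (12)-(13) p.259, (18)-(22) p.260; Balaban1985Variational, (142) p.299] -/
theorem gapFlatAt_of_pos_of_isolated_of_closePair (L : ℕ) (b₀ p₀ : ℝ) (hb₀ : 0 < b₀) (hp₀ : 0 < p₀) (δ : ℝ) (hδ : 0 < δ) :
    ∃ γ₁ : ℝ, 0 < γ₁ ∧ ∀ (F : T3Family) (γ : ℝ), F.L = L → 0 < γ → γ ≤ γ₁ →
      ∀ (J K : ℕ) (hJK : J ≤ K) (ε₀ : ℝ) (V : GaugeField (F.P J) 0 (Matrix.specialUnitaryGroup (Fin 2) ℂ)),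
        ∀ U₀ ∈ fibre F ℰp J K hJK V, U₀ ∈ histGood F ℰp (θBal F.L γ b₀ p₀) K J →
        (∃ r c : ℝ, 0 < r ∧ 0 < c ∧
          ∀ U ∈ closure (fibre F ℰp J K hJK V ∩ histGood F ℰp (θBal F.L γ b₀ p₀) K J),
            (∃ w : Site (F.P K) 0 → Matrix.specialUnitaryGroup (Fin 2) ℂ,
              (∀ U'' : GaugeField (F.P K) 0 (Matrix.specialUnitaryGroup (Fin 2) ℂ),
                  descendTo F ℰp J K hJK (GaugeField.gaugeAct w U'') = descendTo F ℰp J K hJK U'') ∧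
                ∀ ℓ : PBond (F.P K) 0, dist1 (U ℓ * ((GaugeField.gaugeAct w U₀) ℓ)⁻¹) ≤ δ) →
            (⨅ w : {w : Site (F.P K) 0 → Matrix.specialUnitaryGroup (Fin 2) ℂ |
                ∀ U : GaugeField (F.P K) 0 (Matrix.specialUnitaryGroup (Fin 2) ℂ),
                  descendTo F ℰp J K hJK (GaugeField.gaugeAct w U) = descendTo F ℰp J K hJK U},
              ∑ ℓ : PBond (F.P K) 0,
                dist1 (U ℓ * ((GaugeField.gaugeAct (w : Site (F.P K) 0 → Matrix.specialUnitaryGroup (Fin 2) ℂ) U₀) ℓ)⁻¹) ^ 2) ≤ r →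
            c * (⨅ w : {w : Site (F.P K) 0 → Matrix.specialUnitaryGroup (Fin 2) ℂ |
                ∀ U : GaugeField (F.P K) 0 (Matrix.specialUnitaryGroup (Fin 2) ℂ),
                  descendTo F ℰp J K hJK (GaugeField.gaugeAct w U) = descendTo F ℰp J K hJK U},
              ∑ ℓ : PBond (F.P K) 0,
                dist1 (U ℓ * ((GaugeField.gaugeAct (w : Site (F.P K) 0 → Matrix.specialUnitaryGroup (Fin 2) ℂ) U₀) ℓ)⁻¹) ^ 2)
              ≤ wilsonAction4 U - minActionRegPr F J K hJK ε₀ V) →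
        (∀ U ∈ closure (fibre F ℰp J K hJK V ∩ histGood F ℰp (θBal F.L γ b₀ p₀) K J),
            (∃ w : Site (F.P K) 0 → Matrix.specialUnitaryGroup (Fin 2) ℂ,
              (∀ U'' : GaugeField (F.P K) 0 (Matrix.specialUnitaryGroup (Fin 2) ℂ),
                  descendTo F ℰp J K hJK (GaugeField.gaugeAct w U'') = descendTo F ℰp J K hJK U'') ∧
                ∀ ℓ : PBond (F.P K) 0, dist1 (U ℓ * ((GaugeField.gaugeAct w U₀) ℓ)⁻¹) ≤ δ) →
            wilsonAction4 U ≤ minActionRegPr F J K hJK ε₀ V →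
            (⨅ w : {w : Site (F.P K) 0 → Matrix.specialUnitaryGroup (Fin 2) ℂ |
                ∀ U : GaugeField (F.P K) 0 (Matrix.specialUnitaryGroup (Fin 2) ℂ),
                  descendTo F ℰp J K hJK (GaugeField.gaugeAct w U) = descendTo F ℰp J K hJK U},
              ∑ ℓ : PBond (F.P K) 0,
                dist1 (U ℓ * ((GaugeField.gaugeAct (w : Site (F.P K) 0 → Matrix.specialUnitaryGroup (Fin 2) ℂ) U₀) ℓ)⁻¹) ^ 2) = 0) →
        ∃ μ : ℝ, 0 < μ ∧ ∀ U ∈ fibre F ℰp J K hJK V, U ∈ histGood F ℰp (θBal F.L γ b₀ p₀) K J →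
          μ * ((F.L : ℝ)⁻¹) ^ (2 * (K - J)) *
              (⨅ w : {w : Site (F.P K) 0 → Matrix.specialUnitaryGroup (Fin 2) ℂ |
                  ∀ U : GaugeField (F.P K) 0 (Matrix.specialUnitaryGroup (Fin 2) ℂ),
                    descendTo F ℰp J K hJK (GaugeField.gaugeAct w U) = descendTo F ℰp J K hJK U},
                ∑ ℓ : PBond (F.P K) 0,
                  dist1 (U ℓ * ((GaugeField.gaugeAct (w : Site (F.P K) 0 → Matrix.specialUnitaryGroup (Fin 2) ℂ) U₀) ℓ)⁻¹) ^ 2)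
            ≤ wilsonAction4 U - minActionRegPr F J K hJK ε₀ V := by
  obtain ⟨γ₁, hγ₁, hCP⟩ := closePair_holds L b₀ p₀ hb₀ hp₀ δ hδ
  refine ⟨γ₁, hγ₁, fun F γ hFL hγ hγle J K hJK ε₀ V U₀ hU₀f hU₀g hpos hisol => ?_⟩
  obtain ⟨μ, hμ, h⟩ := tubeGrowth_of_pos_of_isolated F hJK V U₀ δ hpos hisol
  refine ⟨μ, hμ, fun U hUf hUg => h U hUf hUg ?_⟩
  exact hCP F γ hFL hγ hγle J K hJK V U₀ hU₀f hU₀g U hUf hUg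

end GapFlat

end Summit.QuantumFields.YangMills.Theorems.FluctuationComparisonRegPrIntLS2BetaTubeGrowthOfIsolated

end
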